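import Mathlib
import Summits.NavierStokesRegularity.NavierStokesRegularity.Theorems.FilamentSkeletonRssAnalyticStripLiaSymbolDefs
import Summits.NavierStokesRegularity.NavierStokesRegularity.Theorems.FilamentSkeletonRssAnalyticStripLiaSymbolAsymp
import Summits.NavierStokesRegularity.NavierStokesRegularity.Theorems.FilamentSkeletonRssAnalyticStripLiaSymbolNumericsCert

/-!
# Route `FilamentSkeletonRss` · crux `SkeletonJ1G` (stmt-27849) · child `TangentSkeletonNearStraight` (stmt-28295) ·
# line `child_tangent_analytic_strip` — STUB P3 `stub_liaSymbol : LiaSymbolBound`, PROVED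

Lane ns-filament-19175-p1 g12 (prover), 2026-08-28, `--supports stmt-NavierStokesRegularity-28295` (registered stub, by name; the
statement `LiaSymbolBound` over `liaSym` is the letter-for-letter copy `…AnalyticStripLiaSymbolDefs` of the line's §2–§3, author
planner-cstrat-…-27849-s1-g2).

`LiaSymbolBound` = three inequalities for the exact static self-induction symbol of the crux's matched (Rosenhead–Moore) kernel,
`𝔖(x) = ∫₀^∞ (1 − cos xh − xh sin xh)(1+h²)^{-3/2} dh` (`= 1 − xK₁(x) − x²K₀(x)`):
* (c) `|𝔖(x) − x²((log(x/2)+γ)/2 + 1/4)| ≤ x⁴(|log x|+1)` on `(0, ½]` — `…LiaSymbolAsymp.liaSym_asymp` (positive-variable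
  representation `…LiaSymbolRep`, `γ = Ein(1) − E₁(1)` `…LiaSymbolGamma`, the two-sided expansion of `E(p) = ∫e^{−t}e^{−p/t}/t`
  `…LiaSymbolExpInt`, Fubini `1 − C(p) = ∫₀^p E`);
* (a) `𝔖(x) ≤ x²/12` (`x > 0`) and (b) `𝔖(x) ≥ −x²/3` (`x ≥ ½`), with `p = x²/4` and `𝔖(x) = Φ(p) = 1 − C(p) − 2pE(p)` (§1):
  `p ≤ 1/50` from the same expansion (`log p ≤ −5 log 2`, `γ < 2/3`); `1/50 ≤ p ≤ 3` from the kernel-replayed bracket-quadrature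
  window `…LiaSymbolNumericsCert.numerics_window` (`−1/12 ≤ Φ ≤ p/3`); `p ≥ 3` from `Φ ≤ 1` and `C, E ≤ 1/(e p)` (§1).

HONEST FRAMING: a lemma about one explicit real integral (the local-induction multiplier bound of a two-phase Newton scheme for a
HYPOTHETICAL filament skeleton) on the NEGATIVE side of a MODEL route.  `TangentSkeletonNearStraight`, `SkeletonJ1G` stay OPEN;
nothing here bears on Navier–Stokes regularity or blow-up.
-/

set_option linter.dupNamespace false

noncomputable section

namespace Summit.NavierStokesRegularity.NavierStokesRegularity.Theorems.AnalyticStripLiaSymbol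

open Real Set MeasureTheory Filter Topology

/-! ## §1  `𝔖 = Φ(x²/4)`, the large-`p` bounds, and the three parts -/

open Numerics in
/-- `𝔖(x) = Φ(x²/4)`. -/
theorem liaSym_eq_Phi (x : ℝ) (hx : x ≠ 0) : liaSym x = Numerics.Phi (x ^ 2 / 4) := by
  have hp : 0 < x ^ 2 / 4 := by positivity
  rw [liaSym_eq_integral_E_sub x hx, ← integral_one_sub_C_eq_integral_E hp.le, Numerics.Phi, Numerics.Cint, Numerics.Eint]
  have h1 : IntegrableOn (fun t : ℝ => Real.exp (-t)) (Ioi 0) := integrableOn_exp_neg_Ioi 0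
  have h2 := Numerics.integrableOn_fC hp.le
  have hsub : ∫ t in Ioi (0:ℝ), Real.exp (-t) * (1 - Real.exp (-(x ^ 2 / 4 / t)))
      = (∫ t in Ioi (0:ℝ), Real.exp (-t)) - ∫ t in Ioi (0:ℝ), Real.exp (-t) * Real.exp (-(x ^ 2 / 4 / t)) := by
    rw [← integral_sub h1 h2]
    refine setIntegral_congr_fun measurableSet_Ioi (fun t _ => ?_)
    ring
  rw [hsub, integral_exp_neg_Ioi_zero]

open Numerics in
/-- `C(p) ≤ 1/(e·p)` (from `y e^{−y} ≤ e^{−1}` and `∫₀^∞ t e^{−t} dt = 1`). -/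
theorem Cint_le_inv {p : ℝ} (hp : 0 < p) : Numerics.Cint p ≤ 1 / (Real.exp 1 * p) := by
  unfold Numerics.Cint
  have hmom : ∫ t in Ioi (0:ℝ), t * Real.exp (-t) = 1 := by
    have := Real.integral_rpow_mul_exp_neg_mul_Ioi (a := 2) (r := 1) (by norm_num) one_pos
    simp only [show (2:ℝ) - 1 = 1 by norm_num, Real.rpow_one, one_mul, div_one, Real.Gamma_two] at this
    simpa using this
  have hI : IntegrableOn (fun t : ℝ => t * Real.exp (-t)) (Ioi 0) := by
    have := Real.GammaIntegral_convergent (s := 2) (by norm_num)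
    refine this.congr_fun (fun t ht => ?_) measurableSet_Ioi
    simp only [show (2:ℝ) - 1 = 1 by norm_num, Real.rpow_one, mul_comm]
  have hpt : ∀ t ∈ Ioi (0:ℝ), Real.exp (-t) * Real.exp (-(p / t)) ≤ (1 / (Real.exp 1 * p)) * (t * Real.exp (-t)) := by
    intro t ht
    have ht : (0:ℝ) < t := ht
    -- `e^{−p/t} ≤ t/(e p)`
    have hy : p / t ≤ Real.exp (p / t - 1) := by linarith [Real.add_one_le_exp (p / t - 1)]
    have hkey : Real.exp (-(p / t)) ≤ t / (Real.exp 1 * p) := by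
      rw [Real.exp_sub] at hy
      rw [Real.exp_neg, le_div_iff₀ (by positivity)]
      rw [div_le_div_iff₀ ht (Real.exp_pos 1)] at hy
      calc (Real.exp (p / t))⁻¹ * (Real.exp 1 * p) = (p * Real.exp 1) / Real.exp (p / t) := by ring
        _ ≤ (Real.exp (p / t) * t) / Real.exp (p / t) := by gcongr
        _ = t := by field_simp
    calc Real.exp (-t) * Real.exp (-(p / t)) ≤ Real.exp (-t) * (t / (Real.exp 1 * p)) := by gcongr
      _ = (1 / (Real.exp 1 * p)) * (t * Real.exp (-t)) := by ring
  calc ∫ t in Ioi (0:ℝ), Real.exp (-t) * Real.exp (-(p / t))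
      ≤ ∫ t in Ioi (0:ℝ), (1 / (Real.exp 1 * p)) * (t * Real.exp (-t)) :=
        setIntegral_mono_on (integrableOn_fC hp.le) (hI.const_mul _) measurableSet_Ioi hpt
    _ = 1 / (Real.exp 1 * p) := by rw [integral_const_mul, hmom, mul_one]

open Numerics in
/-- `E(p) ≤ 1/(e·p)`. -/
theorem Eint_le_inv {p : ℝ} (hp : 0 < p) : Numerics.Eint p ≤ 1 / (Real.exp 1 * p) := by
  unfold Numerics.Eint
  have hI : IntegrableOn (fun t : ℝ => Real.exp (-t)) (Ioi 0) := integrableOn_exp_neg_Ioi 0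
  have hpt : ∀ t ∈ Ioi (0:ℝ), Real.exp (-t) * Real.exp (-(p / t)) / t ≤ (1 / (Real.exp 1 * p)) * Real.exp (-t) := by
    intro t ht
    have ht : (0:ℝ) < t := ht
    have hy : p / t ≤ Real.exp (p / t - 1) := by linarith [Real.add_one_le_exp (p / t - 1)]
    have hkey : Real.exp (-(p / t)) / t ≤ 1 / (Real.exp 1 * p) := by
      rw [Real.exp_sub, div_le_div_iff₀ ht (Real.exp_pos 1)] at hy
      rw [Real.exp_neg, div_le_div_iff₀ ht (by positivity)]
      calc (Real.exp (p / t))⁻¹ * (Real.exp 1 * p) = (p * Real.exp 1) / Real.exp (p / t) := by ring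
        _ ≤ (Real.exp (p / t) * t) / Real.exp (p / t) := by gcongr
        _ = 1 * t := by field_simp
    calc Real.exp (-t) * Real.exp (-(p / t)) / t = Real.exp (-t) * (Real.exp (-(p / t)) / t) := by ring
      _ ≤ Real.exp (-t) * (1 / (Real.exp 1 * p)) := by gcongr
      _ = (1 / (Real.exp 1 * p)) * Real.exp (-t) := by ring
  calc ∫ t in Ioi (0:ℝ), Real.exp (-t) * Real.exp (-(p / t)) / t
      ≤ ∫ t in Ioi (0:ℝ), (1 / (Real.exp 1 * p)) * Real.exp (-t) :=
        setIntegral_mono_on (integrableOn_E_integrand hp) (hI.const_mul _) measurableSet_Ioi hpt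
    _ = 1 / (Real.exp 1 * p) := by rw [integral_const_mul, integral_exp_neg_Ioi_zero, mul_one]

open Numerics in
/-- PART (a): `𝔖(x) ≤ x²/12` for `x > 0`. -/
theorem liaSym_le (x : ℝ) (hx : 0 < x) : liaSym x ≤ x ^ 2 / 12 := by
  set p := x ^ 2 / 4 with hpdef
  have hp : 0 < p := by positivity
  have hx2 : x ^ 2 = 4 * p := by rw [hpdef]; ring
  rcases le_or_gt p (1 / 50) with hsmall | hlarge
  · -- analytic, small p
    have hp1 : p ≤ 1 := by linarith
    have hrep := liaSym_eq_integral_E_sub x hx.ne'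
    rw [show x ^ 2 / 4 = p from rfl] at hrep
    have hIE := (integral_E_bounds hp hp1).2
    have hE := (E_bounds hp hp1).1
    have h2p : (0:ℝ) ≤ 2 * p := by positivity
    have hEp := mul_le_mul_of_nonneg_left hE h2p
    -- log p ≤ log (1/32) = -5 log 2 ≤ -3.4657
    have hlog : Real.log p ≤ -(5 * Real.log 2) := by
      have : Real.log p ≤ Real.log (1 / 32) := Real.log_le_log hp (by linarith)
      rw [one_div, Real.log_inv, show (32:ℝ) = 2 ^ 5 by norm_num, Real.log_pow] at this
      push_cast at this; linarith
    have hl2 := Real.log_two_gt_d9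
    have hγ := Real.eulerMascheroniConstant_lt_two_thirds
    have hγ0 : 0 < Real.eulerMascheroniConstant := lt_trans (by norm_num) Real.one_half_lt_eulerMascheroniConstant
    have h1p : 0 ≤ 1 - p := by linarith
    have hlogp : p * (1 - p) * Real.log p ≤ p * (1 - p) * (-(5 * Real.log 2)) :=
      mul_le_mul_of_nonneg_left hlog (mul_nonneg hp.le h1p)
    have hγp : 2 * p * Real.eulerMascheroniConstant ≤ 2 * p * (2 / 3) :=
      mul_le_mul_of_nonneg_left hγ.le h2p
    have hl2u := Real.log_two_lt_d9
    have hl2p : 0.6931471803 * p ≤ p * Real.log 2 := by nlinarith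
    have hl2pp : p ^ 2 * Real.log 2 ≤ p ^ 2 * 0.6931471808 := by nlinarith [sq_nonneg p]
    have hpp : p ^ 2 ≤ p / 50 := by nlinarith
    rw [hrep, hx2]
    linarith
  rcases le_or_gt p 3 with hmid | hbig
  · -- numerics
    rw [liaSym_eq_Phi x hx.ne', show x ^ 2 / 4 = p from rfl, hx2]
    have := (numerics_window p hlarge.le hmid).1
    linarith
  · -- trivial, large p
    rw [liaSym_eq_Phi x hx.ne', show x ^ 2 / 4 = p from rfl, hx2, Numerics.Phi]
    have hC : 0 ≤ Numerics.Cint p := setIntegral_nonneg measurableSet_Ioi fun t _ => fC_nonneg p t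
    have hE : 0 ≤ Numerics.Eint p := Eint_nonneg p
    nlinarith

open Numerics in
/-- PART (b): `−x²/3 ≤ 𝔖(x)` for `x ≥ ½`. -/
theorem neg_le_liaSym (x : ℝ) (hx : 1 / 2 ≤ x) : -(x ^ 2 / 3) ≤ liaSym x := by
  set p := x ^ 2 / 4 with hpdef
  have hx0 : 0 < x := by linarith
  have hp : 1 / 50 ≤ p := by rw [hpdef]; nlinarith
  have hp0 : 0 < p := by linarith
  have hx2 : x ^ 2 = 4 * p := by rw [hpdef]; ring
  rw [liaSym_eq_Phi x hx0.ne', show x ^ 2 / 4 = p from rfl, hx2]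
  rcases le_or_gt p 3 with hmid | hbig
  · have := (numerics_window p hp hmid).2
    nlinarith
  · -- analytic, large p: `C ≤ 1/(e p)`, `2pE ≤ 2/e`, `e ≥ 2.7`
    unfold Numerics.Phi
    have hC := Cint_le_inv hp0
    have hE := Eint_le_inv hp0
    have he : Real.exp 1 > 2.7 := lt_trans (by norm_num) Real.exp_one_gt_d9
    have hpe : 0 < Real.exp 1 * p := by positivity
    have h1 : Numerics.Cint p ≤ 1 / (2.7 * 3) := by
      refine hC.trans ?_
      rw [div_le_div_iff₀ hpe (by norm_num)]
      nlinarith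
    have h2 : 2 * p * Numerics.Eint p ≤ 2 / 2.7 := by
      have := mul_le_mul_of_nonneg_left hE (by positivity : (0:ℝ) ≤ 2 * p)
      refine this.trans ?_
      rw [show 2 * p * (1 / (Real.exp 1 * p)) = 2 / Real.exp 1 by field_simp]
      exact div_le_div_of_nonneg_left (by norm_num) (by norm_num) he.le
    nlinarith

/-- **THE REGISTERED STUB P3 OF LINE `child_tangent_analytic_strip` (child 28295 of `SkeletonJ1G`)**:
`stub_liaSymbol : LiaSymbolBound` — (a) `𝔖 ≤ x²/12`, (b) `𝔖 ≥ −x²/3` on `x ≥ ½`, (c) the Klein–Majda asymptotics. -/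
theorem stub_liaSymbol : LiaSymbolBound :=
  ⟨liaSym_le, neg_le_liaSym, liaSym_asymp⟩


end Summit.NavierStokesRegularity.NavierStokesRegularity.Theorems.AnalyticStripLiaSymbol
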